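import Summits.CriticalPhenomena.PercolationContinuityZ3.Theorems.Transplant.CayleyQuotientCriticalProb
import Summits.CriticalPhenomena.PercolationContinuityZ3.Theorems.Transplant.WeakCoverGrowth
import HarnessLib

/-!
# Exponential growth — hence `θ(p_c) = 0` on every Cayley graph — is inherited from any QUOTIENT of the group (unconditional)

builds on p205010 (kernel theorem, internal audit signed; external expert review pending) — nothing in this file uses p205010; unconditional, no node
(Hutchcroft's exponential-growth theorem is the PROVED tree theorem `Hutchcroft2016_noPercolationAtCriticality_holds`).
Lane `prim-bschramm`, seat `prim-bschramm-p4` gen 23 (PART C3 of `P4-GENERAL.md` §45.5).  Helper file (`--supports stmt-CriticalPhenomena-4575 --as helper`).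

THE POINT.  `CayleyQuotientCriticalProb` moved the HYPOTHESIS `p_c < 1` up from quotients by the weak-covering monotonicity of `θ`; `WeakCoverGrowth`
moves GROWTH up the same covering.  At the Cayley level: **`CayleyQuot.hasExponentialGrowth_of_quotient`** and
**`CayleyQuot.criticalContinuity_of_quotient_expGrowth` — if `Cay(Q; π(S))` has exponential growth for a quotient `π : Γ ↠ Q`, then `θ_g(p_c) = 0` on
`Cay(Γ; S)`** (Hutchcroft upstairs), with `p_c < 1` (`conj4_nonvacuous_of_quotient_expGrowth`).  Torsion quotients of exponential growth are
included (no free subsemigroup to lift).  Def-free (proof lane).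
[cite: LyonsPeres2016, §6.9, Thm. 6.47; §7.4 Thm. 7.20] [cite: Hutchcroft2016, Thm. 1] [cite: BenjaminiSchramm1996, Conj. 4; Thm. 1]
-/

noncomputable section

namespace Summit.CriticalPhenomena.PercolationContinuityZ3.Theorems.Transplant
open SimpleGraph Filter Literature.Probability.LatticeModels Literature.Probability.Percolation
open Literature.Barriers.CriticalPhenomena
open scoped Classical

/-! ## §2 Cayley graphs: growth and `θ(p_c) = 0` from a quotient of exponential growth -/

namespace CayleyQuot

variable {Γ Q : Type} [Group Γ] [Group Q]

/-- **Exponential growth of a quotient Cayley graph `Cay(Q; π S)` forces exponential growth of `Cay(Γ; S)`** (any homomorphism `π`).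
[cite: LyonsPeres2016, §6.9, §7.4] -/
theorem hasExponentialGrowth_of_quotient (π : Γ →* Q) (S : Finset Γ)
    (hexp : HasExponentialGrowth (mulCayley (↑(S.image π) : Set Q))) : HasExponentialGrowth (mulCayley (↑S : Set Γ)) :=
  WeakCover.hasExponentialGrowth _ _ π (surjOn_neighborSet π S) hexp

/-- **THEOREM (unconditional): a quotient of exponential growth settles Conj. 4 upstairs.**  If `π : Γ ↠ Q`, `Γ = ⟨S⟩`, and `Cay(Q; π(S))` has
exponential growth, then `θ_g(p_c) = 0` on `Cay(Γ; S)` at every vertex (Hutchcroft's theorem applied to `Cay(Γ; S)`, which inherits exponential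
growth). [cite: Hutchcroft2016, Thm. 1] [cite: BenjaminiSchramm1996, Conj. 4] [cite: LyonsPeres2016, §6.9] -/
theorem criticalContinuity_of_quotient_expGrowth (π : Γ →* Q) (S : Finset Γ) (hS : Subgroup.closure (S : Set Γ) = ⊤)
    (hexp : HasExponentialGrowth (mulCayley (↑(S.image π) : Set Q))) (g : Γ) :
    theta (mulCayley (↑S : Set Γ)) g (criticalProbIOf (mulCayley (↑S : Set Γ)) g) = 0 :=
  Hutchcroft2016_noPercolationAtCriticality_holds _ (CayleyScaled.connected_mulCayley_of_closure S hS)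
    (CayleyScaled.isQuasiTransitive_mulCayley S) (hasExponentialGrowth_of_quotient π S hexp) g

/-- **Conj. 4 is a NON-VACUOUS kernel instance upstairs**: `p_c(Cay(Γ;S), g) < 1 ∧ θ_g(p_c) = 0` whenever a quotient Cayley graph `Cay(Q; π S)`
(`π` surjective) has exponential growth. [cite: BenjaminiSchramm1996, Conj. 4; §2 Conj. 1] [cite: Hutchcroft2016, Thm. 1, Thm. 2] -/
theorem conj4_nonvacuous_of_quotient_expGrowth (π : Γ →* Q) (hπ : Function.Surjective π) (S : Finset Γ)
    (hS : Subgroup.closure (S : Set Γ) = ⊤) (hexp : HasExponentialGrowth (mulCayley (↑(S.image π) : Set Q))) (g : Γ) :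
    criticalProb (mulCayley (↑S : Set Γ)) g < 1 ∧ theta (mulCayley (↑S : Set Γ)) g (criticalProbIOf (mulCayley (↑S : Set Γ)) g) = 0 :=
  ⟨criticalProb_lt_one_of_quotient_expGrowth π hπ S hS hexp g, criticalContinuity_of_quotient_expGrowth π S hS hexp g⟩

end CayleyQuot

end Summit.CriticalPhenomena.PercolationContinuityZ3.Theorems.Transplant
end
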